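import Literature.NumberTheory.EllipticCurves.SzpiroFreyProofs
import HarnessLib

/-!
# Szpiro ⟹ abc with exponent `6/5` (Oesterlé, Sém. Bourbaki 694, §2 Remarque (Szpiro), §3)

Trunk `DiophValNum` / family `abc`; companion proof file of
`Literature.NumberTheory.EllipticCurves.Szpiro`, discharging the named fact
`Literature.NumberTheory.EllipticCurves.abc_sixFifths_of_szpiro` (**abc.S10**):

* `Literature.NumberTheory.EllipticCurves.abc_sixFifths_of_szpiro_holds` — Szpiro's conjecture
  (`SzpiroConjecture`, `|Δ_min| ≤ C(ε) N^{6+ε}` for every `E/ℚ`) implies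
  `c ≤ C'(ε) rad(abc)^{6/5+ε}` for every abc triple.

## The printed argument and what is formalised

J. Oesterlé, *Nouvelles approches du «théorème» de Fermat*, Sém. Bourbaki 694, Astérisque 161–162
(1988), read on the page (numdam `SB_1987-1988__30__165_0`):

* §2, p. 167, Prop. 1: Szpiro's conjecture applied to the Frey curve `E_{a,b,c}` in Serre's
  normalisation (`a ≡ −1 (mod 4)`, `16 ∣ b`; minimal discriminant `2⁻⁸(abc)²`, conductor
  `rad(abc)`) gives `|abc| ≤ α' rad(abc)^{β/2}` — exponent `3`, hence only `c ≪ rad^{3/2}`.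
* §2, p. 168, **Remarque (Szpiro)**: `sup(|a|,|b|,|c|) ≤ α'' rad(abc)^{β''}` with `β'' = β/5`,
  `α'' = 2α^{1/5}`: "Cela se déduit de l'inégalité (10), appliquée aux trois courbes elliptiques
  obtenues en quotientant `E_{a,b,c}` par ses sous-groupes d'ordre `2`. Ces courbes elliptiques sont
  semi-stables, ont le même conducteur que `E` et leurs discriminants minimaux sont, avec
  `b' = b/16`," of the shape `a⁴b'c`, `ab'⁴c`, `ab'c⁴` up to bounded powers of `2`.
* §3, p. 169, after Conjecture 3 (abc): "L'énoncé analogue où `1 + ε` est remplacé par `6/5 + ε`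
  est impliqué par la conjecture 2." (Conjecture 2 = Szpiro's conjecture, strong form, p. 168.)

So the proof is the Frey-curve argument run on a **2-isogenous curve** `E'` of the Frey curve
`y² = x(x − A)(x + B)`, namely `E' : y² = x(x² − 2(B − A)x + (A + B)²)` (quotient by `⟨(0,0)⟩`),
whose discriminant `−2⁸·AB·(A+B)⁴` carries a *fourth* power of one member of the triple: with
`|A + B| ≥ c/2` and `|AB| ≥ …` one gets `c⁵ ≪ |Δ_min(E')| ≤ C N^{6+ε} ≪ rad(abc)^{6+ε}`, i.e. the
exponent `6/5`. As in the sibling `SzpiroFreyProofs` (Bombieri–Gubler, Ex. 12.5.10 / proof of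
Thm. 12.5.12) no isogeny theory is needed: we write down explicit integral Weierstrass equations
of `E'` and read off minimality, the conductor exponents and the minimal discriminant from them
with the (proved) local dictionary of `SzpiroLocalDataProofs`:

* first model `⟨0, −2(B − A), 0, (A + B)², 0⟩` — `y² = x³ − 2(B − A)x² + (A + B)²x`,
  `c₄ = 16(A² − 14AB + B²)`,
  `Δ = −2⁸ AB (A + B)⁴`; for coprime `A, B` with `A + B` odd and `16 ∤ AB(A+B)` it is a global
  minimal equation with `N ∣ 2¹² rad(AB(A+B))` (`f₂ < 12` crudely, multiplicative reduction at odd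
  bad primes);
* Serre-normalised model `⟨1, 4m − k, 0, 4m(4k − 1), m(4k − 1)(16m − 4k + 1)⟩` — for
  `A = 4k − 1`, `B = 16m` the substitution
  `x = 4X`, `y = 8Y + 4X` turns the translate `y² = (x + B − A)(x² + 4AB)` of the equation above
  into the integral equation
  `Y² + XY = X³ + (4m − k)X² + 4m(4k − 1)X + m(4k − 1)(16m − 4k + 1)` with
  `c₄ = A² − 14AB + B²` (odd) and `Δ = −(4k − 1)·m·(A + B)⁴ = −2⁻⁴AB(A+B)⁴`: a global minimal
  equation, semistable, `N ∣ rad(AB(A+B))` — Oesterlé's "semi-stables, même conducteur que `E`";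
* `exists_arrangement_odd`, `exists_arrangement_isog` — the signed arrangement `(A, B, A + B)` of
  `{±a, ±b, ±c}` putting an *odd* member `z ≥ c/2` in the fourth-power slot (Oesterlé applies
  Szpiro to all three quotient curves; choosing the right one is this arrangement), with the size
  inequality `c⁵ ≤ 32 |AB(A+B)⁴|`;
* `exists_minimal_isog_model` packages the two cases `16 ∤ abc` / `16 ∣ abc`, and
  `abc_sixFifths_of_szpiro_holds` takes fifth roots.

Our `SzpiroConjecture` is Silverman's form for *all* `E/ℚ` (AEC Conj. VIII.11.1), stronger than
Oesterlé's Conjecture 2 (semi-stable `E` only), so the discharged implication is implied by the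
printed claim; Oesterlé's reduction to `16 ∣ abc` (needed there for semi-stability at `2`) is
replaced by the direct treatment of the case `16 ∤ abc` with the crude bound `f₂ ≤ v₂(Δ) ≤ 11`,
exactly as Bombieri–Gubler do for the Frey curve itself (Ex. 12.5.10, first case).

## References

* J. Oesterlé, *Nouvelles approches du «théorème» de Fermat*, Séminaire Bourbaki, exp. 694
  (1987/88), Astérisque 161–162 (1988), 165–186: §2 Prop. 1 (p. 167), Remarque (Szpiro) (p. 168),
  §3 (p. 169). [Oesterle1988]
* E. Bombieri, W. Gubler, *Heights in Diophantine Geometry*, New Math. Monogr. 4, CUP 2006,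
  Example 12.5.10, Theorem 12.5.12. [BombieriGubler2006]
* J. H. Silverman, *The Arithmetic of Elliptic Curves*, GTM 106, 2nd ed. 2009, VII.1 Remark 1.1,
  VIII.11 Conj. 11.1. [SilvermanAEC2009]
-/

noncomputable section

open UniqueFactorizationMonoid IsDedekindDomain Real WeierstrassCurve Rat.HeightOneSpectrum

namespace Literature.NumberTheory.EllipticCurves

/-! ### Coprimality: the bad primes do not divide `A² − 14AB + B²` -/

/-- For coprime `A, B`, a prime dividing `AB` does not divide `A² − 14AB + B²`. [folklore] -/
theorem not_dvd_c₄Isog_of_dvd_mul {A B : ℤ} (hAB : IsCoprime A B) {p : ℕ} (hp : p.Prime)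
    (h : (p : ℤ) ∣ A * B) : ¬ (p : ℤ) ∣ A ^ 2 - 14 * A * B + B ^ 2 := by
  intro hc
  have hpint : Prime (p : ℤ) := Nat.prime_iff_prime_int.mp hp
  have hnot : ¬ ((p : ℤ) ∣ A ∧ (p : ℤ) ∣ B) := by
    rintro ⟨⟨a, rfl⟩, ⟨b, rfl⟩⟩
    exact hpint.not_unit (hAB.isUnit_of_dvd' (dvd_mul_right _ a) (dvd_mul_right _ b))
  apply hnot
  rcases hpint.dvd_or_dvd h with hA | hB
  · refine ⟨hA, hpint.dvd_of_dvd_pow (n := 2) ?_⟩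
    have : B ^ 2 = (A ^ 2 - 14 * A * B + B ^ 2) - A * (A - 14 * B) := by ring
    rw [this]; exact dvd_sub hc (dvd_mul_of_dvd_left hA _)
  · refine ⟨hpint.dvd_of_dvd_pow (n := 2) ?_, hB⟩
    have : A ^ 2 = (A ^ 2 - 14 * A * B + B ^ 2) - B * (B - 14 * A) := by ring
    rw [this]; exact dvd_sub hc (dvd_mul_of_dvd_left hB _)

/-- For coprime `A, B`, an odd prime dividing `A + B` does not divide
`A² − 14AB + B² = (A + B)² − 16AB`. [folklore] -/
theorem not_dvd_c₄Isog_of_dvd_add {A B : ℤ} (hAB : IsCoprime A B) {p : ℕ} (hp : p.Prime)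
    (hp2 : p ≠ 2) (h : (p : ℤ) ∣ A + B) : ¬ (p : ℤ) ∣ A ^ 2 - 14 * A * B + B ^ 2 := by
  intro hc
  have hpint : Prime (p : ℤ) := Nat.prime_iff_prime_int.mp hp
  have h16AB : (p : ℤ) ∣ 16 * (A * B) := by
    have : 16 * (A * B) = (A + B) ^ 2 - (A ^ 2 - 14 * A * B + B ^ 2) := by ring
    rw [this]; exact dvd_sub (dvd_pow h two_ne_zero) hc
  rcases hpint.dvd_or_dvd h16AB with h16 | hABd
  · exact hp2 (eq_two_of_dvd_sixteen hp h16)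
  · exact not_dvd_c₄Isog_of_dvd_mul hAB hp hABd hc

/-- If `A + B` is odd then `AB` is even. [folklore] -/
theorem two_dvd_mul_of_not_two_dvd_add {A B : ℤ} (h : ¬ (2 : ℤ) ∣ A + B) : (2 : ℤ) ∣ A * B := by
  rcases Int.even_or_odd A with hA | hA
  · exact dvd_mul_of_dvd_left (even_iff_two_dvd.mp hA) _
  · rcases Int.even_or_odd B with hB | hB
    · exact dvd_mul_of_dvd_right (even_iff_two_dvd.mp hB) _
    · exact absurd (even_iff_two_dvd.mp (hA.add_odd hB)) h

/-! ### The two integral models of the 2-isogenous Frey curve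

Both models are used only through their explicit coefficients, so no definitions are introduced:
each section below fixes `W : WeierstrassCurve ℤ` together with the defining hypothesis
`hW : W = ⟨…⟩` (discharged by `rfl` where the models are used).

* First model `W = ⟨0, −2(B − A), 0, (A + B)², 0⟩`, i.e. `y² = x³ − 2(B − A)x² + (A + B)²x`: the
  curve `E'` obtained from the Frey curve `y² = x(x − A)(x + B)` by quotienting by the subgroup
  generated by the `2`-torsion point `(0, 0)` (Vélu: `y² = x(x² + αx + β) ↦
  y² = x(x² − 2αx + α² − 4β)` with `α = B − A`, `β = −AB`, `α² − 4β = (A + B)²`; Oesterlé 1988,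
  §2, Remarque (Szpiro), p. 168: "les trois courbes elliptiques obtenues en quotientant `E_{a,b,c}`
  par ses sous-groupes d'ordre 2").
* Serre-normalised model `W = ⟨1, 4m − k, 0, 4m(4k − 1), m(4k − 1)(16m − 4k + 1)⟩` of the same
  curve for `A = 4k − 1`, `B = 16m`: the substitution `x = 4X`, `y = 8Y + 4X` in the translate
  `y² = (x + B − A)(x² + 4AB)` of the first model gives
  `Y² + XY = X³ + ((B − A − 1)/4) X² + (AB/4) X + AB(B − A)/16` (cf. Oesterlé 1988, §1 (6) for
  the Frey curve itself). -/

section Model1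

variable {A B : ℤ} {W : WeierstrassCurve ℤ} (hW : W = ⟨0, -(2 * (B - A)), 0, (A + B) ^ 2, 0⟩)
include hW

/-- `c₄` of the first model `W = ⟨0, −2(B − A), 0, (A + B)², 0⟩`: `c₄ = 16 (A² − 14AB + B²)`.
[folklore] -/
theorem freyIsogModel_c₄ : W.c₄ = 16 * (A ^ 2 - 14 * A * B + B ^ 2) := by
  subst hW
  simp only [WeierstrassCurve.c₄, WeierstrassCurve.b₂, WeierstrassCurve.b₄]
  ring

/-- `Δ` of the first model `W = ⟨0, −2(B − A), 0, (A + B)², 0⟩`: `Δ = −2⁸ · AB · (A + B)⁴`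
(Oesterlé 1988, p. 168: the minimal discriminants of the `2`-quotients of the Frey curve carry a
fourth power of one of `a, b, c`). [cite: Oesterle1988, §2 Remarque (Szpiro), p. 168] -/
theorem freyIsogModel_Δ : W.Δ = -(256 * (A * B) * (A + B) ^ 4) := by
  subst hW
  simp only [WeierstrassCurve.Δ, WeierstrassCurve.b₂, WeierstrassCurve.b₄,
    WeierstrassCurve.b₆, WeierstrassCurve.b₈]
  ring

/-! ### The first model: minimality and conductor when `A + B` is odd and `16 ∤ AB(A+B)` -/

/-- The first model `W ⊗ ℚ` is an elliptic curve when `AB(A+B) ≠ 0`. [folklore] -/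
theorem isElliptic_freyIsogModel (h0 : A * B * (A + B) ≠ 0) :
    (W.baseChange ℚ).IsElliptic := by
  refine ⟨?_⟩
  rw [baseChange_int_Δ, freyIsogModel_Δ hW, isUnit_iff_ne_zero]
  have hAB : A * B ≠ 0 := left_ne_zero_of_mul h0
  have hApB : A + B ≠ 0 := right_ne_zero_of_mul h0
  exact_mod_cast neg_ne_zero.mpr
    (mul_ne_zero (mul_ne_zero (by norm_num) hAB) (pow_ne_zero 4 hApB))

/-- A prime dividing `Δ = −2⁸ AB (A+B)⁴` divides `AB(A+B)` (for `p = 2`: one of `A + B`, `AB` is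
even). [folklore] -/
theorem dvd_of_dvd_freyIsogModel_Δ {p : ℕ} (hp : p.Prime)
    (h : (p : ℤ) ∣ W.Δ) : (p : ℤ) ∣ A * B * (A + B) := by
  have hpint : Prime (p : ℤ) := Nat.prime_iff_prime_int.mp hp
  rw [freyIsogModel_Δ hW, dvd_neg] at h
  rcases hpint.dvd_or_dvd h with h1 | h2
  · rcases hpint.dvd_or_dvd h1 with h256 | hABd
    · have hp2 : p = 2 := by
        have : (p : ℤ) ∣ 2 ^ 8 := by simpa using h256
        have := Int.natCast_dvd_natCast.mp
          (by exact_mod_cast hpint.dvd_of_dvd_pow this : (p : ℤ) ∣ (2 : ℕ))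
        exact (Nat.prime_dvd_prime_iff_eq hp Nat.prime_two).mp this
      subst hp2
      by_cases h2 : (2 : ℤ) ∣ A + B
      · exact_mod_cast dvd_mul_of_dvd_right h2 (A * B)
      · exact_mod_cast dvd_mul_of_dvd_left (two_dvd_mul_of_not_two_dvd_add h2) (A + B)
    · exact dvd_mul_of_dvd_left hABd _
  · exact dvd_mul_of_dvd_right (hpint.dvd_of_dvd_pow h2) _

/-- `ord₂`-bookkeeping: if `A + B` is odd and `16 ∤ AB(A+B)` then `2¹² ∤ Δ = −2⁸ AB (A+B)⁴`.
[folklore] -/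
theorem not_two_pow_twelve_dvd_freyIsogModel_Δ (hodd : ¬ (2 : ℤ) ∣ A + B)
    (h16 : ¬ (16 : ℤ) ∣ A * B * (A + B)) : ¬ (2 : ℤ) ^ 12 ∣ W.Δ := by
  rw [freyIsogModel_Δ hW, dvd_neg]
  intro h
  have h' : (2 : ℤ) ^ 8 * 16 ∣ (2 : ℤ) ^ 8 * (A * B * (A + B) ^ 4) := by
    have e1 : (2 : ℤ) ^ 12 = 2 ^ 8 * 16 := by norm_num
    have e2 : 256 * (A * B) * (A + B) ^ 4 = (2 : ℤ) ^ 8 * (A * B * (A + B) ^ 4) := by ring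
    rwa [e1, e2] at h
  have h'' : (16 : ℤ) ∣ A * B * (A + B) ^ 4 := (mul_dvd_mul_iff_left (by norm_num)).mp h'
  have hcop : IsCoprime (16 : ℤ) ((A + B) ^ 4) := by
    have h2 : IsCoprime (2 : ℤ) (A + B) := (Int.prime_two.coprime_iff_not_dvd).mpr hodd
    have := h2.pow (m := 4) (n := 4)
    norm_num at this
    exact this
  have : (16 : ℤ) ∣ A * B := hcop.dvd_of_dvd_mul_right h''
  exact h16 (dvd_mul_of_dvd_left this _)

/-- For coprime `A, B`, an odd prime dividing `AB(A+B)` does not divide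
`c₄ = 16 (A² − 14AB + B²)`. [folklore] -/
theorem not_dvd_freyIsogModel_c₄ (hAB : IsCoprime A B) {p : ℕ} (hp : p.Prime) (hp2 : p ≠ 2)
    (h : (p : ℤ) ∣ A * B * (A + B)) : ¬ (p : ℤ) ∣ W.c₄ := by
  rw [freyIsogModel_c₄ hW]
  intro hc
  have hpint : Prime (p : ℤ) := Nat.prime_iff_prime_int.mp hp
  rcases hpint.dvd_or_dvd hc with h16 | hg
  · exact hp2 (eq_two_of_dvd_sixteen hp h16)
  · rcases hpint.dvd_or_dvd h with hABd | hApB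
    · exact not_dvd_c₄Isog_of_dvd_mul hAB hp hABd hg
    · exact not_dvd_c₄Isog_of_dvd_add hAB hp hp2 hApB hg

/-- If `A, B` are coprime, `A + B` is odd and `16 ∤ AB(A+B)` (`AB(A+B) ≠ 0`), then
the first model `W` is a global minimal Weierstrass equation: at odd bad primes `p ∤ c₄`, at
`2` and at the good primes `p¹² ∤ Δ` (Silverman AEC VII.1, Remark 1.1). [folklore] -/
theorem isMinimalAt_freyIsogModel (hAB : IsCoprime A B) (hodd : ¬ (2 : ℤ) ∣ A + B)
    (h16 : ¬ (16 : ℤ) ∣ A * B * (A + B)) (v : HeightOneSpectrum ℤ) :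
    (W.baseChange ℚ).IsMinimalAt v := by
  set p := natGenerator v with hp
  have hpp : p.Prime := prime_natGenerator v
  by_cases hpm : (p : ℤ) ∣ A * B * (A + B)
  · by_cases h2 : p = 2
    · refine isMinimalAt_baseChange_int_of_not_pow_dvd_Δ ?_
      rw [← hp, h2]
      exact_mod_cast not_two_pow_twelve_dvd_freyIsogModel_Δ hW hodd h16
    · refine isMinimalAt_baseChange_int_of_not_dvd_c₄ ?_
      rw [← hp]
      exact not_dvd_freyIsogModel_c₄ hW hAB hpp h2 hpm
  · refine isMinimalAt_baseChange_int_of_not_pow_dvd_Δ ?_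
    rw [← hp]
    exact fun h ↦ hpm
      (dvd_of_dvd_freyIsogModel_Δ hW hpp (dvd_trans (dvd_pow_self _ (by norm_num)) h))

/-- Conductor of the first model: `N ∣ 2¹² rad(AB(A+B))` — `f₂ < 12` since `2¹² ∤ Δ`
(`f₂ ≤ ord₂ Δ_min`), `f_p = 1` at odd `p ∣ AB(A+B)` (multiplicative reduction: `p ∣ Δ`, `p ∤ c₄`),
`f_p = 0` otherwise (cf. Bombieri–Gubler Ex. 12.5.10, first case, for the Frey curve). [folklore] -/
theorem conductorNorm_freyIsogModel_dvd (hAB : IsCoprime A B) (h0 : A * B * (A + B) ≠ 0)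
    (hodd : ¬ (2 : ℤ) ∣ A + B) (h16 : ¬ (16 : ℤ) ∣ A * B * (A + B)) :
    (W.baseChange ℚ).conductorNorm ℤ ∣
      2 ^ 12 * radical (A * B * (A + B)).natAbs := by
  haveI := isElliptic_freyIsogModel hW h0
  set m := A * B * (A + B) with hm
  have hm0 : m.natAbs ≠ 0 := Int.natAbs_ne_zero.mpr h0
  refine conductorNorm_dvd_of_forall_conductorExponent_le _
    (mul_ne_zero (by positivity) radical_ne_zero) fun p ↦ ?_
  obtain ⟨v, hv⟩ := exists_place p
  obtain ⟨p, hp⟩ := p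
  simp only at hv ⊢
  have hmin := isMinimalAt_freyIsogModel hW hAB hodd h16 v
  have hpint : Prime (p : ℤ) := Nat.prime_iff_prime_int.mp hp
  rw [show (primesEquiv (R := ℤ)).symm ⟨p, hp⟩ = v from
      (primesEquiv (R := ℤ)).symm_apply_eq.mpr (Subtype.ext hv.symm),
    Nat.factorization_mul (by positivity) radical_ne_zero, Finsupp.add_apply,
    DiophantineGeometry.factorization_radical_apply hm0 hp,
    Nat.Prime.factorization_pow Nat.prime_two, Finsupp.single_apply]
  by_cases h2 : p = 2
  · subst h2
    have : (W.baseChange ℚ).conductorExponent v < 12 := by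
      refine conductorExponent_lt_of_not_pow_dvd hmin ?_
      rw [hv]
      exact_mod_cast not_two_pow_twelve_dvd_freyIsogModel_Δ hW hodd h16
    rw [if_pos rfl]; omega
  rw [if_neg (Ne.symm h2), zero_add]
  by_cases hpm : (p : ℤ) ∣ m
  · rw [if_pos (Int.natCast_dvd.mp hpm)]
    refine (conductorExponent_eq_one_of_dvd_Δ_of_not_dvd_c₄ hmin ?_ ?_).le
    · rw [hv, freyIsogModel_Δ hW, dvd_neg]
      have : 256 * (A * B) * (A + B) ^ 4 = m * (256 * (A + B) ^ 3) := by rw [hm]; ring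
      rw [this]
      exact dvd_mul_of_dvd_left hpm _
    · rw [hv]
      exact not_dvd_freyIsogModel_c₄ hW hAB hp h2 hpm
  · rw [if_neg (mt Int.natCast_dvd.mpr hpm)]
    refine (conductorExponent_eq_zero_of_not_dvd_Δ hmin ?_).le
    rw [hv]
    exact fun h ↦ hpm (dvd_of_dvd_freyIsogModel_Δ hW hp h)

end Model1

/-! ### The Serre-normalised model: minimality and conductor (`A = 4k − 1`, `B = 16m`) -/

section Model2

variable {k m : ℤ} {W : WeierstrassCurve ℤ}
  (hW : W = ⟨1, 4 * m - k, 0, 4 * m * (4 * k - 1), m * (4 * k - 1) * (16 * m - 4 * k + 1)⟩)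
include hW

/-- `c₄` of the Serre-normalised model `W = ⟨1, 4m − k, 0, 4m(4k − 1), m(4k − 1)(16m − 4k + 1)⟩`:
`c₄ = A² − 14AB + B²` with `A = 4k − 1`, `B = 16m` (odd). [folklore] -/
theorem freyIsogModel₂_c₄ :
    W.c₄ = (4 * k - 1) ^ 2 - 14 * (4 * k - 1) * (16 * m) + (16 * m) ^ 2 := by
  subst hW
  simp only [WeierstrassCurve.c₄, WeierstrassCurve.b₂, WeierstrassCurve.b₄]
  ring

/-- `Δ` of the Serre-normalised model `W = ⟨1, 4m − k, 0, 4m(4k − 1), m(4k − 1)(16m − 4k + 1)⟩`: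
`Δ = −(4k − 1) · m · (A + B)⁴ = −2⁻⁴ AB (A + B)⁴` with `A = 4k − 1`, `B = 16m` (Oesterlé 1988,
p. 168, "avec `b' = b/16`"). [cite: Oesterle1988, §2 Remarque (Szpiro), p. 168] -/
theorem freyIsogModel₂_Δ : W.Δ = -((4 * k - 1) * m * (4 * k - 1 + 16 * m) ^ 4) := by
  subst hW
  simp only [WeierstrassCurve.Δ, WeierstrassCurve.b₂, WeierstrassCurve.b₄,
    WeierstrassCurve.b₆, WeierstrassCurve.b₈]
  ring

/-- The Serre-normalised model `W ⊗ ℚ` is an elliptic curve when `AB(A+B) ≠ 0`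
(`A = 4k − 1`, `B = 16m`). [folklore] -/
theorem isElliptic_freyIsogModel₂
    (h0 : (4 * k - 1) * (16 * m) * (4 * k - 1 + 16 * m) ≠ 0) :
    (W.baseChange ℚ).IsElliptic := by
  refine ⟨?_⟩
  rw [baseChange_int_Δ, freyIsogModel₂_Δ hW, isUnit_iff_ne_zero]
  have hA : (4 * k - 1 : ℤ) ≠ 0 := by omega
  have hApB : (4 * k - 1 + 16 * m : ℤ) ≠ 0 := by omega
  have hm : m ≠ 0 := by
    rintro rfl
    simp at h0
  exact_mod_cast neg_ne_zero.mpr (mul_ne_zero (mul_ne_zero hA hm) (pow_ne_zero 4 hApB))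

/-- A prime dividing `Δ = −(4k − 1) m (A + B)⁴` divides `AB(A+B)` (`A = 4k − 1`, `B = 16m`).
[folklore] -/
theorem dvd_of_dvd_freyIsogModel₂_Δ {p : ℕ} (hp : p.Prime)
    (h : (p : ℤ) ∣ W.Δ) :
    (p : ℤ) ∣ (4 * k - 1) * (16 * m) * (4 * k - 1 + 16 * m) := by
  have hpint : Prime (p : ℤ) := Nat.prime_iff_prime_int.mp hp
  rw [freyIsogModel₂_Δ hW, dvd_neg] at h
  rcases hpint.dvd_or_dvd h with h1 | h2
  · rcases hpint.dvd_or_dvd h1 with hA | hm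
    · exact dvd_mul_of_dvd_left (dvd_mul_of_dvd_left hA _) _
    · exact dvd_mul_of_dvd_left (dvd_mul_of_dvd_right (dvd_mul_of_dvd_right hm _) _) _
  · exact dvd_mul_of_dvd_right (hpint.dvd_of_dvd_pow h2) _

/-- For coprime `A = 4k − 1`, `B = 16m`, a prime dividing `AB(A+B)` does not divide
`c₄ = A² − 14AB + B²` (for `p ∣ A + B` note `A + B` is odd, so `p ≠ 2`). [folklore] -/
theorem not_dvd_freyIsogModel₂_c₄ (hAB : IsCoprime (4 * k - 1) (16 * m)) {p : ℕ}
    (hp : p.Prime) (h : (p : ℤ) ∣ (4 * k - 1) * (16 * m) * (4 * k - 1 + 16 * m)) :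
    ¬ (p : ℤ) ∣ W.c₄ := by
  rw [freyIsogModel₂_c₄ hW]
  have hpint : Prime (p : ℤ) := Nat.prime_iff_prime_int.mp hp
  rcases hpint.dvd_or_dvd h with hABd | hApB
  · exact not_dvd_c₄Isog_of_dvd_mul hAB hp hABd
  · refine not_dvd_c₄Isog_of_dvd_add hAB hp ?_ hApB
    rintro rfl
    have h2 : ((2 : ℕ) : ℤ) ∣ 4 * k - 1 + 16 * m := hApB
    push_cast at h2
    omega

/-- For coprime `A = 4k − 1`, `B = 16m`, the Serre-normalised model `W` is a global minimal
Weierstrass equation: `p ∤ c₄` at every bad prime (in particular `c₄` is odd), `p ∤ Δ` at the others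
(Oesterlé 1988, p. 168: the `2`-quotients of the Serre-normalised Frey curve are semi-stable).
[cite: Oesterle1988, §2 Remarque (Szpiro), p. 168] -/
theorem isMinimalAt_freyIsogModel₂ (hAB : IsCoprime (4 * k - 1) (16 * m))
    (v : HeightOneSpectrum ℤ) : (W.baseChange ℚ).IsMinimalAt v := by
  set p := natGenerator v with hp
  have hpp : p.Prime := prime_natGenerator v
  by_cases hpm : (p : ℤ) ∣ (4 * k - 1) * (16 * m) * (4 * k - 1 + 16 * m)
  · refine isMinimalAt_baseChange_int_of_not_dvd_c₄ ?_
    rw [← hp]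
    exact not_dvd_freyIsogModel₂_c₄ hW hAB hpp hpm
  · refine isMinimalAt_baseChange_int_of_not_pow_dvd_Δ ?_
    rw [← hp]
    exact fun h ↦ hpm
      (dvd_of_dvd_freyIsogModel₂_Δ hW hpp (dvd_trans (dvd_pow_self _ (by norm_num)) h))

/-- Conductor of the Serre-normalised model: multiplicative reduction at every bad prime, so
`N ∣ rad(AB(A+B))` (Oesterlé 1988, p. 168: "semi-stables, ont le même conducteur que `E`",
`N_E = rad(abc)` by §1 (9)). [cite: Oesterle1988, §2 Remarque (Szpiro), p. 168] -/
theorem conductorNorm_freyIsogModel₂_dvd (hAB : IsCoprime (4 * k - 1) (16 * m))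
    (h0 : (4 * k - 1) * (16 * m) * (4 * k - 1 + 16 * m) ≠ 0) :
    (W.baseChange ℚ).conductorNorm ℤ ∣
      radical ((4 * k - 1) * (16 * m) * (4 * k - 1 + 16 * m)).natAbs := by
  haveI := isElliptic_freyIsogModel₂ hW h0
  set n := (4 * k - 1) * (16 * m) * (4 * k - 1 + 16 * m) with hn
  have hn0 : n.natAbs ≠ 0 := Int.natAbs_ne_zero.mpr h0
  refine conductorNorm_dvd_of_forall_conductorExponent_le _ radical_ne_zero fun p ↦ ?_
  obtain ⟨v, hv⟩ := exists_place p
  obtain ⟨p, hp⟩ := p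
  simp only at hv ⊢
  have hmin := isMinimalAt_freyIsogModel₂ hW hAB v
  rw [show (primesEquiv (R := ℤ)).symm ⟨p, hp⟩ = v from
      (primesEquiv (R := ℤ)).symm_apply_eq.mpr (Subtype.ext hv.symm),
    DiophantineGeometry.factorization_radical_apply hn0 hp]
  by_cases hpm : (p : ℤ) ∣ n
  · rw [if_pos (Int.natCast_dvd.mp hpm)]
    have hc₄ : ¬ (natGenerator v : ℤ) ∣ W.c₄ := by
      rw [hv]; exact not_dvd_freyIsogModel₂_c₄ hW hAB hp hpm
    by_cases hΔ : (natGenerator v : ℤ) ∣ W.Δ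
    · exact (conductorExponent_eq_one_of_dvd_Δ_of_not_dvd_c₄ hmin hΔ hc₄).le
    · exact (conductorExponent_eq_zero_of_not_dvd_Δ hmin hΔ).trans_le zero_le_one
  · rw [if_neg (mt Int.natCast_dvd.mpr hpm)]
    refine (conductorExponent_eq_zero_of_not_dvd_Δ hmin ?_).le
    rw [hv]
    exact fun h ↦ hpm (dvd_of_dvd_freyIsogModel₂_Δ hW hp h)

end Model2

/-! ### Arrangements: an odd member `≥ c/2` in the fourth-power slot -/

/-- The size inequality behind the exponent `6/5`: if `0 ≤ c ≤ 2z` and `c ≤ 2xy` then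
`c⁵ ≤ 32 · xy · z⁴` (Oesterlé 1988, p. 168: `α'' = 2 α'^{1/5}`, `β'' = β/5`). [folklore] -/
theorem pow_five_le_of_le {x y z c : ℤ} (hc : 0 ≤ c) (hz : c ≤ 2 * z) (hxy : c ≤ 2 * (x * y)) :
    c ^ 5 ≤ 32 * (x * y * z ^ 4) := by
  have h1 : c ^ 4 ≤ (2 * z) ^ 4 := pow_le_pow_left₀ hc hz 4
  calc c ^ 5 = c * c ^ 4 := by ring
    _ ≤ (2 * (x * y)) * (2 * z) ^ 4 := mul_le_mul hxy h1 (by positivity) (by linarith)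
    _ = 32 * (x * y * z ^ 4) := by ring

/-- Arrangement for the first model: every abc triple `(a, b, c)` has a signed arrangement
`(A, B, A + B)` of `{±a, ±b, ±c}` with `A, B` coprime, `A + B` odd and `c⁵ ≤ 32 |AB(A+B)⁴|`
(`(A, B) = (a, b)` if `c` is odd, `(c, −min(a,b))` if `c` is even). [folklore] -/
theorem exists_arrangement_odd {a b c : ℕ} (h : DiophantineGeometry.IsABCTriple a b c) :
    ∃ A B : ℤ, IsCoprime A B ∧ ¬ (2 : ℤ) ∣ A + B ∧
      (A * B * (A + B)).natAbs = a * b * c ∧ (c : ℤ) ^ 5 ≤ 32 * |A * B * (A + B) ^ 4| := by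
  wlog hle : a ≤ b generalizing a b
  · obtain ⟨ha, hb, habc, hcop⟩ := h
    have h' : DiophantineGeometry.IsABCTriple b a c := ⟨hb, ha, by omega, hcop.symm⟩
    obtain ⟨A, B, h1, h2, h3, h4⟩ := this h' (by omega)
    exact ⟨A, B, h1, h2, by rw [h3]; ring, h4⟩
  obtain ⟨ha, hb, habc, hcop⟩ := h
  have hab : IsCoprime (a : ℤ) (b : ℤ) := Nat.isCoprime_iff_coprime.mpr hcop
  have hac : IsCoprime (a : ℤ) (c : ℤ) := by
    have : (c : ℤ) = a + b := by rw [← habc]; push_cast; ring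
    rw [this]
    exact Nat.isCoprime_iff_coprime.mpr (Nat.coprime_self_add_right.mpr hcop)
  have hP : ((a * b * c : ℕ) : ℤ) = a * b * (a + b) := by rw [← habc]; push_cast; ring
  have hc' : (c : ℤ) = a + b := by rw [← habc]; push_cast; ring
  have ha1 : (1 : ℤ) ≤ a := by exact_mod_cast ha
  have hb1 : (1 : ℤ) ≤ b := by exact_mod_cast hb
  have hle' : (a : ℤ) ≤ b := by exact_mod_cast hle
  have hc0 : (0 : ℤ) ≤ c := by positivity
  have h2ab : (c : ℤ) ≤ 2 * (a * b) := by
    rw [hc']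
    nlinarith [mul_nonneg (sub_nonneg.mpr ha1) (sub_nonneg.mpr hb1)]
  by_cases hc2 : 2 ∣ c
  · -- `c` even, `a ≤ b`: `(A, B) = (c, -a)`, `A + B = b` odd
    have hb2 : ¬ 2 ∣ b := by
      intro hb2
      have ha2 : 2 ∣ a := (Nat.dvd_add_left hb2).mp (habc ▸ hc2)
      have := Nat.dvd_gcd ha2 hb2
      rw [hcop.gcd_eq_one] at this
      omega
    refine ⟨c, -a, hac.symm.neg_right, by omega, ?_, ?_⟩
    · rw [show (c : ℤ) * (-(a : ℤ)) * (c + -a) = -((a * b * c : ℕ) : ℤ) by rw [hP, hc']; ring,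
        Int.natAbs_neg, Int.natAbs_natCast]
    · have e : (c : ℤ) * (-(a : ℤ)) * ((c : ℤ) + -(a : ℤ)) ^ 4 = -((c : ℤ) * a * b ^ 4) := by
        rw [hc']; ring
      rw [e, abs_neg, abs_of_nonneg (by positivity)]
      exact pow_five_le_of_le hc0 (by linarith) (by nlinarith)
  · -- `c` odd: `(A, B) = (a, b)`
    refine ⟨a, b, hab, by omega, ?_, ?_⟩
    · rw [show (a : ℤ) * b * (a + b) = ((a * b * c : ℕ) : ℤ) by rw [hP], Int.natAbs_natCast]
    · have e : (a : ℤ) * b * ((a : ℤ) + b) ^ 4 = (a : ℤ) * b * c ^ 4 := by rw [hc']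
      rw [e, abs_of_nonneg (by positivity)]
      exact pow_five_le_of_le hc0 (by linarith) h2ab

/-- Arrangement for the Serre-normalised model (Oesterlé 1988, §1 (5): "`a ≡ −1 (mod 4)`,
`b ≡ 0 (mod 16)`", obtained by permuting `a, b, c` when `16 ∣ abc`): an abc triple with `16 ∣ abc`
has a signed arrangement `(A, B, A + B)` of `{±a, ±b, ±c}` with `A, B` coprime,
`A ≡ −1 (mod 4)`, `16 ∣ B`, and the odd member `|A + B| ≥ c/2`, so that `c⁵ ≤ 32 |AB(A+B)⁴|`.
[cite: Oesterle1988, §1 (5) and §2 Prop. 1, p. 167] -/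
theorem exists_arrangement_isog {a b c : ℕ} (h : DiophantineGeometry.IsABCTriple a b c)
    (h16 : 16 ∣ a * b * c) :
    ∃ A B : ℤ, IsCoprime A B ∧ 4 ∣ A + 1 ∧ (16 : ℤ) ∣ B ∧
      (A * B * (A + B)).natAbs = a * b * c ∧ (c : ℤ) ^ 5 ≤ 32 * |A * B * (A + B) ^ 4| := by
  wlog hle : a ≤ b generalizing a b
  · obtain ⟨ha, hb, habc, hcop⟩ := h
    have h' : DiophantineGeometry.IsABCTriple b a c := ⟨hb, ha, by omega, hcop.symm⟩
    obtain ⟨A, B, h1, h2, h3, h4, h5⟩ := this h' (by rwa [mul_comm b a]) (by omega)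
    exact ⟨A, B, h1, h2, h3, by rw [h4]; ring, h5⟩
  obtain ⟨ha, hb, habc, hcop⟩ := h
  have hab : IsCoprime (a : ℤ) (b : ℤ) := Nat.isCoprime_iff_coprime.mpr hcop
  have hac : IsCoprime (a : ℤ) (c : ℤ) := by
    have : (c : ℤ) = a + b := by rw [← habc]; push_cast; ring
    rw [this]
    exact Nat.isCoprime_iff_coprime.mpr (Nat.coprime_self_add_right.mpr hcop)
  have hP : ((a * b * c : ℕ) : ℤ) = a * b * (a + b) := by rw [← habc]; push_cast; ring
  have hc' : (c : ℤ) = a + b := by rw [← habc]; push_cast; ring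
  have ha1 : (1 : ℤ) ≤ a := by exact_mod_cast ha
  have hb1 : (1 : ℤ) ≤ b := by exact_mod_cast hb
  have hle' : (a : ℤ) ≤ b := by exact_mod_cast hle
  have hc0 : (0 : ℤ) ≤ c := by positivity
  have h2ab : (c : ℤ) ≤ 2 * (a * b) := by
    rw [hc']
    nlinarith [mul_nonneg (sub_nonneg.mpr ha1) (sub_nonneg.mpr hb1)]
  -- parity: exactly one of `a, b, c` is even, and it is divisible by `16`
  have hodd2 : ¬ (2 ∣ a ∧ 2 ∣ b) := by
    rintro ⟨h2a, h2b⟩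
    have := Nat.dvd_gcd h2a h2b
    rw [hcop.gcd_eq_one] at this
    omega
  rcases Nat.even_or_odd a with ha2 | ha2
  · -- `a` even, `b` and `c` odd, `16 ∣ a`: `(A, B) = ±(b, a)`, `A + B = ±c`
    have hb2 : Odd b := Nat.odd_iff.mpr (by rcases ha2 with ⟨k, hk⟩; omega)
    have hc2 : Odd c := by rw [← habc]; exact ha2.add_odd hb2
    have h16a : 16 ∣ a := by
      have hco : Nat.Coprime 16 (b * c) := by
        rw [show (16 : ℕ) = 2 ^ 4 by norm_num]
        exact Nat.Coprime.pow_left 4 (Nat.coprime_two_left.mpr (hb2.mul hc2))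
      exact hco.dvd_of_dvd_mul_right (by simpa [mul_assoc] using h16)
    have e1 : (b : ℤ) * a * ((b : ℤ) + a) ^ 4 = (b : ℤ) * a * c ^ 4 := by rw [hc']; ring
    have e2 : (-(b : ℤ)) * (-(a : ℤ)) * (-(b : ℤ) + -(a : ℤ)) ^ 4 = (b : ℤ) * a * c ^ 4 := by
      rw [hc']; ring
    have hsize : (c : ℤ) ^ 5 ≤ 32 * ((b : ℤ) * a * c ^ 4) :=
      pow_five_le_of_le hc0 (by linarith) (by linarith [mul_comm (a : ℤ) b])
    rcases (show b % 4 = 1 ∨ b % 4 = 3 by rcases hb2 with ⟨k, rfl⟩; omega) with hb4 | hb4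
    · refine ⟨-b, -a, hab.symm.neg_left.neg_right, by omega, by omega, ?_, ?_⟩
      · rw [show (-(b : ℤ)) * (-(a : ℤ)) * (-b + -a) = -((a * b * c : ℕ) : ℤ) by rw [hP]; ring,
          Int.natAbs_neg, Int.natAbs_natCast]
      · rwa [e2, abs_of_nonneg (by positivity)]
    · refine ⟨b, a, hab.symm, by omega, by omega, ?_, ?_⟩
      · rw [show (b : ℤ) * a * (b + a) = ((a * b * c : ℕ) : ℤ) by rw [hP]; ring, Int.natAbs_natCast]
      · rwa [e1, abs_of_nonneg (by positivity)]
  rcases Nat.even_or_odd b with hb2 | hb2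
  · -- `b` even, `a` and `c` odd, `16 ∣ b`: `(A, B) = ±(a, b)`, `A + B = ±c`
    have hc2 : Odd c := by rw [← habc]; exact ha2.add_even hb2
    have h16b : 16 ∣ b := by
      have hco : Nat.Coprime 16 (a * c) := by
        rw [show (16 : ℕ) = 2 ^ 4 by norm_num]
        exact Nat.Coprime.pow_left 4 (Nat.coprime_two_left.mpr (ha2.mul hc2))
      refine hco.dvd_of_dvd_mul_left (by simpa [mul_comm, mul_assoc, mul_left_comm] using h16)
    have e1 : (a : ℤ) * b * ((a : ℤ) + b) ^ 4 = (a : ℤ) * b * c ^ 4 := by rw [hc']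
    have e2 : (-(a : ℤ)) * (-(b : ℤ)) * (-(a : ℤ) + -(b : ℤ)) ^ 4 = (a : ℤ) * b * c ^ 4 := by
      rw [hc']; ring
    have hsize : (c : ℤ) ^ 5 ≤ 32 * ((a : ℤ) * b * c ^ 4) :=
      pow_five_le_of_le hc0 (by linarith) h2ab
    rcases (show a % 4 = 1 ∨ a % 4 = 3 by rcases ha2 with ⟨k, rfl⟩; omega) with ha4 | ha4
    · refine ⟨-a, -b, hab.neg_left.neg_right, by omega, by omega, ?_, ?_⟩
      · rw [show (-(a : ℤ)) * (-(b : ℤ)) * (-a + -b) = -((a * b * c : ℕ) : ℤ) by rw [hP]; ring,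
          Int.natAbs_neg, Int.natAbs_natCast]
      · rwa [e2, abs_of_nonneg (by positivity)]
    · refine ⟨a, b, hab, by omega, by omega, ?_, ?_⟩
      · rw [show (a : ℤ) * b * (a + b) = ((a * b * c : ℕ) : ℤ) by rw [hP], Int.natAbs_natCast]
      · rwa [e1, abs_of_nonneg (by positivity)]
  · -- `a`, `b` odd, `c` even, `16 ∣ c`, `a ≤ b`: `(A, B) = ±(a, -c)`, `A + B = ∓b`
    have hc2 : Even c := by rw [← habc]; exact ha2.add_odd hb2
    have h16c : 16 ∣ c := by
      have hco : Nat.Coprime 16 (a * b) := by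
        rw [show (16 : ℕ) = 2 ^ 4 by norm_num]
        exact Nat.Coprime.pow_left 4 (Nat.coprime_two_left.mpr (ha2.mul hb2))
      exact hco.dvd_of_dvd_mul_left h16
    have e1 : (a : ℤ) * (-(c : ℤ)) * ((a : ℤ) + -(c : ℤ)) ^ 4 = -((a : ℤ) * c * b ^ 4) := by
      rw [hc']; ring
    have e2 : (-(a : ℤ)) * c * (-(a : ℤ) + c) ^ 4 = -((a : ℤ) * c * b ^ 4) := by rw [hc']; ring
    have hsize : (c : ℤ) ^ 5 ≤ 32 * ((a : ℤ) * c * b ^ 4) :=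
      pow_five_le_of_le hc0 (by linarith) (by nlinarith)
    rcases (show a % 4 = 1 ∨ a % 4 = 3 by rcases ha2 with ⟨k, rfl⟩; omega) with ha4 | ha4
    · refine ⟨-a, c, hac.neg_left, by omega, by omega, ?_, ?_⟩
      · rw [show (-(a : ℤ)) * c * (-a + c) = -((a * b * c : ℕ) : ℤ) by rw [hP, hc']; ring,
          Int.natAbs_neg, Int.natAbs_natCast]
      · rwa [e2, abs_neg, abs_of_nonneg (by positivity)]
    · refine ⟨a, -c, hac.neg_right, by omega, by omega, ?_, ?_⟩
      · rw [show (a : ℤ) * (-(c : ℤ)) * (a + -c) = ((a * b * c : ℕ) : ℤ) by rw [hP, hc']; ring,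
          Int.natAbs_natCast]
      · rwa [e1, abs_neg, abs_of_nonneg (by positivity)]

/-! ### Packaging: a global minimal equation with `N ∣ 2¹² rad(abc)` and `c⁵ ≤ 2⁹ |Δ|` -/

/-- Every abc triple `(a, b, c)` carries a global minimal Weierstrass equation `W₀` over `ℤ` of a
`2`-quotient of a Frey curve — the first model of `exists_arrangement_odd` if `16 ∤ abc`, the
Serre-normalised model of `exists_arrangement_isog` if `16 ∣ abc` — with `N ∣ 2¹² rad(abc)` and
`c⁵ ≤ 2⁹ |Δ(W₀)|` (Oesterlé 1988, §2 Remarque (Szpiro), p. 168, together with the reduction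
"se ramener au cas où `16 ∣ abc`" of §3, p. 169, here replaced by the direct first case).
[cite: Oesterle1988, §2 Remarque (Szpiro), p. 168] -/
theorem exists_minimal_isog_model {a b c : ℕ} (h : DiophantineGeometry.IsABCTriple a b c) :
    ∃ W₀ : WeierstrassCurve ℤ, (W₀.baseChange ℚ).IsElliptic ∧
      (∀ v : HeightOneSpectrum ℤ, (W₀.baseChange ℚ).IsMinimalAt v) ∧
      (W₀.baseChange ℚ).conductorNorm ℤ ∣ 2 ^ 12 * DiophantineGeometry.rad a b c ∧
      (c : ℤ) ^ 5 ≤ 512 * |W₀.Δ| := by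
  have h' := h
  obtain ⟨ha, hb, habc, hcop⟩ := h'
  have hc : 0 < c := by omega
  have habc0 : a * b * c ≠ 0 := by positivity
  by_cases h16 : 16 ∣ a * b * c
  · obtain ⟨A, B, hAB, hA, hB, hprod, hsize⟩ := exists_arrangement_isog h h16
    obtain ⟨k, hk⟩ := hA
    obtain ⟨m, rfl⟩ := hB
    obtain rfl : A = 4 * k - 1 := by omega
    have h0 : (4 * k - 1) * (16 * m) * (4 * k - 1 + 16 * m) ≠ 0 := by
      rw [← Int.natAbs_ne_zero, hprod]; exact habc0
    refine ⟨⟨1, 4 * m - k, 0, 4 * m * (4 * k - 1), m * (4 * k - 1) * (16 * m - 4 * k + 1)⟩,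
      isElliptic_freyIsogModel₂ rfl h0, isMinimalAt_freyIsogModel₂ rfl hAB, ?_, ?_⟩
    · rw [DiophantineGeometry.rad_def, ← hprod]
      exact (conductorNorm_freyIsogModel₂_dvd rfl hAB h0).trans (dvd_mul_left _ _)
    · rw [freyIsogModel₂_Δ rfl, abs_neg]
      have e : (4 * k - 1) * (16 * m) * (4 * k - 1 + 16 * m) ^ 4 =
          16 * ((4 * k - 1) * m * (4 * k - 1 + 16 * m) ^ 4) := by ring
      rw [e, abs_mul, abs_of_pos (by norm_num : (0 : ℤ) < 16)] at hsize
      linarith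
  · obtain ⟨A, B, hAB, hodd, hprod, hsize⟩ := exists_arrangement_odd h
    have h0 : A * B * (A + B) ≠ 0 := by
      rw [← Int.natAbs_ne_zero, hprod]; exact habc0
    have h16' : ¬ (16 : ℤ) ∣ A * B * (A + B) := by
      have : ¬ ((16 : ℕ) : ℤ) ∣ A * B * (A + B) := fun hd ↦ h16 (hprod ▸ Int.natCast_dvd.mp hd)
      exact_mod_cast this
    refine ⟨⟨0, -(2 * (B - A)), 0, (A + B) ^ 2, 0⟩, isElliptic_freyIsogModel rfl h0,
      isMinimalAt_freyIsogModel rfl hAB hodd h16', ?_, ?_⟩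
    · have := conductorNorm_freyIsogModel_dvd rfl hAB h0 hodd h16'
      rwa [hprod, ← DiophantineGeometry.rad_def] at this
    · rw [freyIsogModel_Δ rfl, abs_neg]
      have e : 256 * (A * B) * (A + B) ^ 4 = 256 * (A * B * (A + B) ^ 4) := by ring
      rw [e, abs_mul, abs_of_pos (by norm_num : (0 : ℤ) < 256)]
      linarith [abs_nonneg (A * B * (A + B) ^ 4)]

/-! ### Oesterlé 1988, §3: Szpiro ⟹ abc with exponent `6/5` -/

/-- **abc.S10, discharged** (Oesterlé, Sém. Bourbaki 694 (1988), §3, p. 169: "L'énoncé analogue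
où `1 + ε` est remplacé par `6/5 + ε` est impliqué par la conjecture 2", proved via §2, Remarque
(Szpiro), p. 168). Szpiro's conjecture implies `c ≤ C(ε) rad(abc)^{6/5+ε}` for all abc triples:
apply `SzpiroConjecture` (with `5ε`) to the global minimal equation `W₀` of
`exists_minimal_isog_model` (`|Δ_min| = |Δ(W₀)|` by `minimalDiscriminantNorm_eq_natAbs_holds`),
so that `c⁵ ≤ 2⁹ |Δ_min| ≤ 2⁹ C N^{6+5ε} ≤ 2⁹ C (2¹² rad(abc))^{6+5ε}`, and take fifth roots.
[cite: Oesterle1988, §3, p. 169] -/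
theorem abc_sixFifths_of_szpiro_holds : abc_sixFifths_of_szpiro := by
  intro hS ε hε
  obtain ⟨C₁, hC₁⟩ := hS (5 * ε) (by positivity)
  set C : ℝ := max C₁ 1 with hCdef
  have hC0 : 0 < C := one_pos.trans_le (le_max_right _ _)
  set M : ℝ := 512 * C * ((2 : ℝ) ^ 12) ^ (6 + 5 * ε) with hMdef
  have hM0 : 0 ≤ M := by positivity
  refine ⟨M ^ (1 / 5 : ℝ), fun a b c h ↦ ?_⟩
  obtain ⟨W₀, hE, hmin, hN, hc5⟩ := exists_minimal_isog_model h
  haveI := hE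
  have key := hC₁ (W₀.baseChange ℚ)
  rw [minimalDiscriminantNorm_eq_natAbs_holds W₀ (Δ_ne_zero_of_isElliptic_baseChange_int W₀) hmin,
    Nat.cast_natAbs, Int.cast_abs] at key
  set N : ℝ := (((W₀.baseChange ℚ).conductorNorm ℤ : ℕ) : ℝ) with hNdef
  set R : ℝ := ((DiophantineGeometry.rad a b c : ℕ) : ℝ) with hRdef
  have hN0 : 0 ≤ N := by positivity
  have hR0 : 0 ≤ R := by positivity
  -- `|Δ| ≤ C N^{6+5ε}`
  have h1 : |(W₀.Δ : ℝ)| ≤ C * N ^ (6 + 5 * ε) :=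
    key.trans (mul_le_mul_of_nonneg_right (le_max_left _ _) (by positivity))
  -- `N ≤ 2¹² R`
  have h2 : N ≤ 2 ^ 12 * R := by
    have := Nat.le_of_dvd (mul_pos (by positivity)
      (by rw [DiophantineGeometry.rad_def]; exact Nat.radical_pos _)) hN
    rw [hNdef, hRdef]; exact_mod_cast this
  -- `c⁵ ≤ 2⁹ |Δ| ≤ M R^{6+5ε}`
  have h3 : (c : ℝ) ^ 5 ≤ M * R ^ (6 + 5 * ε) := by
    have hc : (c : ℝ) ^ 5 ≤ 512 * |(W₀.Δ : ℝ)| := by exact_mod_cast hc5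
    calc (c : ℝ) ^ 5 ≤ 512 * |(W₀.Δ : ℝ)| := hc
      _ ≤ 512 * (C * N ^ (6 + 5 * ε)) := by linarith
      _ ≤ 512 * (C * (2 ^ 12 * R) ^ (6 + 5 * ε)) := by gcongr
      _ = M * R ^ (6 + 5 * ε) := by
          rw [hMdef, Real.mul_rpow (by positivity) hR0]; ring
  -- fifth roots
  have h4 := Real.rpow_le_rpow (by positivity) h3 (by norm_num : (0 : ℝ) ≤ 1 / 5)
  rw [← Real.rpow_natCast (c : ℝ) 5, ← Real.rpow_mul (by positivity),
    Real.mul_rpow hM0 (by positivity), ← Real.rpow_mul hR0] at h4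
  norm_num at h4
  rwa [show (6 + 5 * ε) * (1 / 5) = 6 / 5 + ε by ring] at h4

end Literature.NumberTheory.EllipticCurves
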